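import Summits.ValiantsHypothesis.ValiantsHypothesis.Theorems.SymPencilPerFourBlocks

/-!
# Route `SymPencil` — subspaces along which `per_4` is "affine + c·(linear)²" have dimension `≤ 4`
# (the `per_4`-combinatorics of the rung `sdc(per_4) ≥ 19`, `--supports` stmt-ValiantsHypothesis-5674)

Strengthening of `SymPencilPerFourBlocks.finrank_le_four_of_affine`: let `W` be a subspace of
`4 × 4` matrices over a field of characteristic `0` and `c` a constant such that for every `u` there
is a linear functional `Λ_u` with

  `per_4 (u + s y) = e₀ + s e₁ + s² · c · Λ_u(y)²`   for all `y ∈ W` and all `s`.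

Then `dim W ≤ 4` (`finrank_le_four_of_sq`).  At `u₀ = E₂₂ + E₃₃` this says that the `2 × 2`
subpermanent `y₀₀y₁₁ + y₀₁y₁₀` restricted to `W` is `c Λ²` (a square), and likewise for every
`2 × 2` block by symmetry (`perm_two_blocks_eq_sq`); in the row filtration of
`finrank_le_four_of_perm_two_blocks` a square `c Λ²` that vanishes at `x` has no cross term with
`x`, so the level pairings still vanish and the count `≤ 4` goes through
(`finrank_le_four_of_perm_two_blocks_sq`).  This is the shape produced by
`SymPencilIsotropicKernelDefect` for a symmetric representation of `per_4` of size `18`. [folklore]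
-/

noncomputable section

-- single-conjunct layout: Sub = Summit, duplicated namespace component intended
set_option linter.dupNamespace false

namespace Summit.ValiantsHypothesis.ValiantsHypothesis.Theorems.SymPencilPerFourBlocksSq

open Matrix MvPolynomial Finset Module
open Literature.Computability.AlgebraicComplexity
open Literature.Computability.AlgebraicComplexity.AlperBogartVelasco
open Summit.ValiantsHypothesis.ValiantsHypothesis.Theorems.SymPencilPerFourBlocks

variable {K : Type*} [Field K]

/-- From `per_4 (E₂₂ + E₃₃ + s y) = e₀ + s e₁ + s² c t²`: the `2 × 2` subpermanent on
rows/columns `{0,1}` equals `c t²`. [folklore] -/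
theorem perm_two_zero_one_eq_sq [CharZero K] (y : Fin 4 × Fin 4 → K) (c t : K)
    (h : ∃ e₀ e₁ : K, ∀ s : K,
      eval ((fun p : Fin 4 × Fin 4 => if p = (2, 2) then (1 : K) else if p = (3, 3) then 1 else 0) +
        s • y) (perPoly (Fin 4) K) = e₀ + s * e₁ + s ^ 2 * (c * t ^ 2)) :
    y (0, 0) * y (1, 1) + y (0, 1) * y (1, 0) = c * t ^ 2 := by
  obtain ⟨e₀, e₁, he⟩ := h
  obtain ⟨c₃, c₄, hc⟩ := eval_perPoly_two_units_add_smul y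
  set q := y (0, 0) * y (1, 1) + y (0, 1) * y (1, 0) with hq
  have P : ∀ s : K, s ^ 2 * q + s ^ 3 * c₃ + s ^ 4 * c₄ = e₀ + s * e₁ + s ^ 2 * (c * t ^ 2) :=
    fun s => by rw [← hc s, he s]
  have h0 := P 0
  have h1 := P 1
  have h1' := P (-1)
  have h2 := P 2
  have h2' := P (-2)
  have h24 : (24 : K) * (q - c * t ^ 2) = 0 := by
    linear_combination 16 * (h1 + h1') - (h2 + h2') - 30 * h0
  have h24' : (24 : K) ≠ 0 := by norm_num
  exact sub_eq_zero.1 ((mul_eq_zero.1 h24).resolve_left h24')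

/-- **Every `2 × 2` subpermanent restricted to `W` is `c` times a square of a linear form.**
[folklore] -/
theorem perm_two_blocks_eq_sq [CharZero K] (W : Submodule K (Fin 4 × Fin 4 → K)) (c : K)
    (hW : ∀ u : Fin 4 × Fin 4 → K, ∃ Λ : (Fin 4 × Fin 4 → K) →ₗ[K] K, ∀ y ∈ W, ∃ e₀ e₁ : K,
      ∀ s : K, eval (u + s • y) (perPoly (Fin 4) K) = e₀ + s * e₁ + s ^ 2 * (c * (Λ y) ^ 2)) :
    ∀ i k j l : Fin 4, i ≠ k → j ≠ l → ∃ Λ : (Fin 4 × Fin 4 → K) →ₗ[K] K, ∀ y ∈ W,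
      y (i, j) * y (k, l) + y (i, l) * y (k, j) = c * (Λ y) ^ 2 := by
  intro i k j l hik hjl
  obtain ⟨σ, hσ0, hσ1⟩ := exists_perm_zero_one i k hik
  obtain ⟨τ, hτ0, hτ1⟩ := exists_perm_zero_one j l hjl
  set e := Equiv.prodCongr σ τ with he
  set u₀ : Fin 4 × Fin 4 → K :=
    fun p => if p = (2, 2) then (1 : K) else if p = (3, 3) then 1 else 0 with hu₀
  obtain ⟨Λ, hΛ⟩ := hW (u₀ ∘ e.symm)
  refine ⟨Λ, fun y hy => ?_⟩
  obtain ⟨e₀, e₁, h⟩ := hΛ y hy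
  have h' : ∃ e₀ e₁ : K, ∀ s : K,
      eval (u₀ + s • (y ∘ e)) (perPoly (Fin 4) K) = e₀ + s * e₁ + s ^ 2 * (c * (Λ y) ^ 2) := by
    refine ⟨e₀, e₁, fun s => ?_⟩
    have hcomp : u₀ + s • (y ∘ e) = (u₀ ∘ e.symm + s • y) ∘ e := by
      ext p
      simp
    rw [hcomp, he, eval_perPoly_comp_prodCongr, ← he, h s]
  have h2 := perm_two_zero_one_eq_sq (y ∘ e) c (Λ y) h'
  simp only [Function.comp_apply, he, Equiv.prodCongr_apply, Prod.map_apply, hσ0, hσ1, hτ0,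
    hτ1] at h2
  exact h2

/-- **A subspace of `4 × 4` matrices on which every `2 × 2` subpermanent is `c` times a square of
a linear form has dimension `≤ 4`.** [folklore] -/
theorem finrank_le_four_of_perm_two_blocks_sq (W : Submodule K (Fin 4 × Fin 4 → K)) (c : K)
    (hB : ∀ i k j l : Fin 4, i ≠ k → j ≠ l → ∃ Λ : (Fin 4 × Fin 4 → K) →ₗ[K] K, ∀ y ∈ W,
      y (i, j) * y (k, l) + y (i, l) * y (k, j) = c * (Λ y) ^ 2) :
    finrank K W ≤ 4 := by
  -- rows as linear maps and the flag
  let ρ : Fin 4 → (Fin 4 × Fin 4 → K) →ₗ[K] (Fin 4 → K) :=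
    fun r => LinearMap.funLeft K K fun j => (r, j)
  have hρ : ∀ r x j, ρ r x j = x (r, j) := fun _ _ _ => rfl
  let V₂ : Submodule K (Fin 4 × Fin 4 → K) := W ⊓ LinearMap.ker (ρ 3)
  let V₁ : Submodule K (Fin 4 × Fin 4 → K) := V₂ ⊓ LinearMap.ker (ρ 2)
  let V₀ : Submodule K (Fin 4 × Fin 4 → K) := V₁ ⊓ LinearMap.ker (ρ 1)
  let V : Fin 4 → Submodule K (Fin 4 × Fin 4 → K) := ![V₀, V₁, V₂, W]
  have hV0 : V 0 = V₀ := rfl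
  have hV1 : V 1 = V₁ := rfl
  have hV2 : V 2 = V₂ := rfl
  have hV3 : V 3 = W := rfl
  have memV : ∀ p, ∀ x ∈ V p, x ∈ W ∧ ∀ r, p < r → ∀ j, x (r, j) = 0 := by
    have hcases : ∀ i : Fin 4, i = 0 ∨ i = 1 ∨ i = 2 ∨ i = 3 := by decide
    intro p x hx
    rcases hcases p with rfl | rfl | rfl | rfl
    · rw [hV0] at hx
      simp only [V₀, V₁, V₂, Submodule.mem_inf, LinearMap.mem_ker] at hx
      obtain ⟨⟨⟨hW', h3⟩, h2⟩, h1⟩ := hx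
      refine ⟨hW', fun r hr j => ?_⟩
      rcases hcases r with rfl | rfl | rfl | rfl
      · exact absurd hr (by decide)
      · exact congr_fun h1 j
      · exact congr_fun h2 j
      · exact congr_fun h3 j
    · rw [hV1] at hx
      simp only [V₁, V₂, Submodule.mem_inf, LinearMap.mem_ker] at hx
      obtain ⟨⟨hW', h3⟩, h2⟩ := hx
      refine ⟨hW', fun r hr j => ?_⟩
      rcases hcases r with rfl | rfl | rfl | rfl
      · exact absurd hr (by decide)
      · exact absurd hr (by decide)
      · exact congr_fun h2 j
      · exact congr_fun h3 j
    · rw [hV2] at hx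
      simp only [V₂, Submodule.mem_inf, LinearMap.mem_ker] at hx
      obtain ⟨hW', h3⟩ := hx
      refine ⟨hW', fun r hr j => ?_⟩
      rcases hcases r with rfl | rfl | rfl | rfl
      · exact absurd hr (by decide)
      · exact absurd hr (by decide)
      · exact absurd hr (by decide)
      · exact congr_fun h3 j
    · rw [hV3] at hx
      refine ⟨hx, fun r hr j => ?_⟩
      exact absurd (Fin.le_last r) (not_le.2 hr)
  have hdim : finrank K W = ∑ p, finrank K ((V p).map (ρ p)) := by
    have hbot : (V₀ ⊓ LinearMap.ker (ρ 0) : Submodule K _) = ⊥ := by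
      rw [eq_bot_iff]
      intro x hx
      rw [Submodule.mem_inf, LinearMap.mem_ker] at hx
      obtain ⟨-, hrows⟩ := memV 0 x hx.1
      have h0 : ∀ j, x (0, j) = 0 := fun j => congr_fun hx.2 j
      rw [Submodule.mem_bot]
      funext ⟨i, j⟩
      by_cases hi : i = 0
      · subst hi; exact h0 j
      · exact hrows i (by
          have : (0 : Fin 4) ≤ i := Fin.zero_le i
          exact lt_of_le_of_ne this (Ne.symm hi)) j
    rw [Fin.sum_univ_four, hV0, hV1, hV2, hV3,
      finrank_eq_finrank_map_add_finrank_inf_ker W (ρ 3),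
      finrank_eq_finrank_map_add_finrank_inf_ker V₂ (ρ 2),
      finrank_eq_finrank_map_add_finrank_inf_ker V₁ (ρ 1),
      finrank_eq_finrank_map_add_finrank_inf_ker V₀ (ρ 0), hbot, finrank_bot]
    ring
  -- the pairing between two levels: a square `c Λ²` vanishing at `x` has no cross term with `x`
  have hpair : ∀ (p q : Fin 4) (x x' : Fin 4 × Fin 4 → K), x ∈ W → x' ∈ W →
      (∀ j, x (q, j) = 0) → ∀ j l, j ≠ l → p ≠ q →
      x (p, j) * x' (q, l) + x (p, l) * x' (q, j) = 0 := by
    intro p q x x' hx hx' hxq j l hjl hpq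
    obtain ⟨Λ, hΛ⟩ := hB p q j l hpq hjl
    have h1 := hΛ (x + x') (W.add_mem hx hx')
    have h2 := hΛ x' hx'
    have h3 := hΛ x hx
    rw [map_add] at h1
    simp only [Pi.add_apply, hxq, zero_add] at h1
    simp only [hxq, mul_zero, add_zero] at h3
    have h4 : c * Λ x = 0 := by
      have h5 : (c * Λ x) * Λ x = 0 := by rw [mul_assoc, ← pow_two]; exact h3.symm
      rcases mul_eq_zero.1 h5 with h | h
      · exact h
      · rw [h, mul_zero]
    linear_combination h1 - h2 + (Λ x + 2 * Λ x') * h4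
  have hP : ∀ p q, p ≠ q → ∀ u ∈ (V p).map (ρ p), ∀ v ∈ (V q).map (ρ q),
      ∀ j l, j ≠ l → u j * v l + u l * v j = 0 := by
    intro p q hpq u hu v hv j l hjl
    rw [Submodule.mem_map] at hu hv
    obtain ⟨x, hx, rfl⟩ := hu
    obtain ⟨x', hx', rfl⟩ := hv
    obtain ⟨hxW, hxr⟩ := memV p x hx
    obtain ⟨hx'W, hx'r⟩ := memV q x' hx'
    simp only [hρ]
    rcases lt_or_gt_of_ne hpq with hlt | hgt
    · exact hpair p q x x' hxW hx'W (hxr q hlt) j l hjl hpq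
    · have h := hpair q p x' x hx'W hxW (hx'r p hgt) l j hjl.symm hpq.symm
      linear_combination h
  have hle : ∀ i, finrank K ((V i).map (ρ i)) ≤ 4 := fun i =>
    (((V i).map (ρ i)).finrank_le).trans (by rw [finrank_fintype_fun_eq_card, Fintype.card_fin])
  have hPL : ∀ p q, p ≠ q → 1 ≤ finrank K ((V q).map (ρ q)) →
      finrank K ((V p).map (ρ p)) ≤ 1 := by
    intro p q hpq hq
    have hne : (V q).map (ρ q) ≠ ⊥ := fun h => by
      rw [h, finrank_bot] at hq; exact absurd hq (by decide)
    obtain ⟨v, hv, hv0⟩ := Submodule.exists_mem_ne_zero_of_ne_bot hne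
    obtain ⟨c₀, hc₀⟩ : ∃ c₀, v c₀ ≠ 0 := by
      by_contra hall
      push Not at hall
      exact hv0 (funext hall)
    refine finrank_le_one_of_pairings _ v hc₀ fun u hu j hj => ?_
    exact hP p q hpq u hu v hv c₀ j (Ne.symm hj)
  rw [hdim]
  exact sum_le_four_of_pairs (fun i => finrank K ((V i).map (ρ i))) hle hPL

/-- **Subspaces along which `per_4` is "affine + c·(linear)²" have dimension `≤ 4`.**
[folklore] -/
theorem finrank_le_four_of_sq [CharZero K] (W : Submodule K (Fin 4 × Fin 4 → K)) (c : K)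
    (hW : ∀ u : Fin 4 × Fin 4 → K, ∃ Λ : (Fin 4 × Fin 4 → K) →ₗ[K] K, ∀ y ∈ W, ∃ e₀ e₁ : K,
      ∀ s : K, eval (u + s • y) (perPoly (Fin 4) K) = e₀ + s * e₁ + s ^ 2 * (c * (Λ y) ^ 2)) :
    finrank K W ≤ 4 :=
  finrank_le_four_of_perm_two_blocks_sq W c (perm_two_blocks_eq_sq W c hW)

end Summit.ValiantsHypothesis.ValiantsHypothesis.Theorems.SymPencilPerFourBlocksSq

end
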